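import Summits.AtomisticToContinuum.HydrodynamicLimit.Theorems.MourreKoopmanChargesOneBodyCompletenessFlowContinuity
import HarnessLib

/-!
# `OneBodyCompleteness` · line `registered`, stub `stub_flowMeanSquareContinuity` (part 2 of 2): CLOSED
# (right mean-square continuity of the hard-sphere flow on the one-body cell observables)

Support file for the crux item stmt-AtomisticToContinuum-9583 (`OneBodyCompleteness`, route
`MourreKoopmanCharges` of `AtomisticToContinuum/HydrodynamicLimit`), line `registered`
(`Cruxes/OneBodyCompleteness/Lines/birth.lean`, skeleton v7), closing the registered stub
`stub_flowMeanSquareContinuity` VERBATIM — hypothesis (D2) of the landed reduction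
`dynamicClusteringOneBody_of`: for every unit-diameter equilibrium flow `Φ`, every DLR state `G` of unit
hard spheres at unit inverse temperature (any activity `z > 0`) and every continuous polynomially bounded `h`,

  `∫ (A_h ∘ Φ_t - A_h)² dG → 0` as `t → 0⁺`, `A_h(ω) = Σ_{(q,v) ∈ ω, q ∈ [0,1)³} h(v)`.

This is Doyon's strong continuity of the dynamics on the GNS space (Doyon 2022 Thm 4.11) for the one-body
cell observables, DERIVED here from the structure axioms of `InfiniteHardSphereFlow` (per-particle free
flight up to the first collision, finitely many collisions of each particle in bounded space-time,
`coe_flow`) and stationarity — no uniform regularity of Alexander's solutions — by a STATIONARITY COUNT,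
with the toolkit of part 1 (`…FlowContinuity.lean`: measurable membership, transport of cell observables by
free flight, initial free flight, null faces, Vitali along a measure-preserving family).

## Proof (the stationarity count)

Write `C = [0,1)³`, `N(ω) = #(ω ∩ C × ℝ³) ∈ [0, ∞]` (notation `𝒩[ω]`), `f_t(q, v) = (q + t v, v)` and
`M_t(ω) = #{p ∈ ω | p₁ ∈ C, p₁ + t p₂ ∈ C, f_t(p) ∈ Φ_t ω}` (notation `ℳ[Φ, t, ω]`, the count of the
*tracked section* `𝒯[Φ, t, ω]`: the particles of the cell that are found, freely flown, in the cell of the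
evolved configuration).  All sets are written out (file-local notation, no definitions).

* MEASURABILITY (`measurable_trackedCount`): `{(ω, p) | f_t p ∈ Φ_t ω}` is jointly measurable
  (part 1, `measurableSet_mem_config`), so `M_t` is a measurably parametrised count
  (`PointConfig.measurable_toMeasure_preimage`).
* SURE INEQUALITIES (`trackedCount_le_cellCount`, `trackedCount_le_cellCount_flow`): `M_t ≤ N` and, `f_t`
  being injective and mapping the tracked set into `Φ_t ω ∩ C × ℝ³`, `M_t(ω) ≤ N(Φ_t ω)`.
* EXACT TRANSPORT OFF THE BAD EVENT (`cellObs_flow_eq`): off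
  `bad_t = {1 ≤ N ∘ Φ_t - M_t} ∪ {1 ≤ N - M_t} ∪ {N = ∞}` (notation `ℬ[Φ, t]`, measurable) both inclusions
  are equalities of finite sets, `Φ_t ω ∩ C × ℝ³ = f_t(ω ∩ C × ℝ³)`, so `A_h(Φ_t ω) = A_h(ω)` for EVERY `h`.
* A.S. EVENTUAL EQUALITY (`eventually_trackedCount_eq`): for a good face-free `ω` every one of the
  finitely many particles over `C` is tracked for all small `t ≥ 0` (initial free flight, `coe_flow`,
  openness of the cube), so `M_t(ω) = N(ω)` eventually; good and face-free are almost sure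
  (`IsAEDefined`, part 1 `measure_faceEvent`).
* STATIONARITY COUNT (`tendsto_measure_badSet`): `N ≤ 8` a.s. (packing), `E_G[M_t] → E_G[N]` (dominated
  convergence), `E_G[N ∘ Φ_t] = E_G[N]` (`IsStationary.measurePreserving`); by Markov
  `G(bad_t) ≤ G{1 ≤ N ∘ Φ_t - M_t} + G{1 ≤ N - M_t} + G{N = ∞} ≤ 2 (E_G[N] - E_G[M_t]) → 0` as `t → 0⁺`.
* THE STUB (`stub_flowMeanSquareContinuity`): `A_h ∈ L²(G)` (`memLp_two_cellObs_of_isHardSphereGibbs`),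
  the `Φ_t` preserve `G`, `A_h ∘ Φ_t = A_h` off `bad_t`, `G(bad_t) → 0`: Vitali (part 1,
  `tendsto_integral_sq_sub_of_measure_tendsto_zero`).

References: B. Doyon, *Hydrodynamic projections and the emergence of linearised Euler equations in
one-dimensional isolated systems*, Comm. Math. Phys. 391 (2022), §4.3 Thm 4.11; R. Alexander, *Time
evolution for infinitely many hard spheres*, Comm. Math. Phys. 49 (1976), §2.1, Def. 4.8 (a), Thm 5.2;
H. Spohn, *Large Scale Dynamics of Interacting Particles* (1991), Part I §7.1.
-/

noncomputable section

open MeasureTheory ProbabilityTheory Filter Topology Set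
open scoped ENNReal

namespace Summit.AtomisticToContinuum.HydrodynamicLimit.Theorems.MourreKoopmanChargesOneBodyCompleteness

open Literature.MathematicalPhysics.KineticTheory Literature.Analysis.FluidPDE
open Literature.Analysis.FunctionSpaces (PointConfig)
open Summit.AtomisticToContinuum.HydrodynamicLimit.Theorems.MourreKoopmanChargesStressStrongMixing
  (memLp_two_cellObs_of_isHardSphereGibbs)

/-! ### File-local notation (no definitions): counts, tracked sections, the bad event -/

/-- `𝒩[ω] ∈ [0, ∞]`: the number of particles of `ω` with position in the unit cell `[0,1)³`. -/
local notation3 "𝒩[" ω "]" => (((PointConfig.count ω (Prod.fst ⁻¹' unitCell) : ℕ∞)) : ℝ≥0∞)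

/-- `𝒯[Φ, t, ω]`: the *tracked section* — phase points over the cell whose free flight for time `t` is over
the cell AND is a particle of the evolved configuration `Φ_t ω`. -/
local notation3 "𝒯[" Φ ", " t ", " ω "]" =>
  {p : V3 × V3 | p.1 ∈ unitCell ∧ p.1 + (t : ℝ) • p.2 ∈ unitCell ∧
    (p.1 + (t : ℝ) • p.2, p.2) ∈ InfiniteHardSphereFlow.flow Φ t ω}

/-- `ℳ[Φ, t, ω] ∈ [0, ∞]`: the number of particles of `ω` in the tracked section. -/
local notation3 "ℳ[" Φ ", " t ", " ω "]" => (((PointConfig.count ω 𝒯[Φ, t, ω] : ℕ∞)) : ℝ≥0∞)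

/-- `ℬ[Φ, t]`: the bad event `{1 ≤ N ∘ Φ_t - M_t} ∪ {1 ≤ N - M_t} ∪ {N = ∞}`. -/
local notation3 "ℬ[" Φ ", " t "]" =>
  (({ω : MarkedConfig | (1 : ℝ≥0∞) ≤ 𝒩[InfiniteHardSphereFlow.flow Φ t ω] - ℳ[Φ, t, ω]} ∪
      {ω : MarkedConfig | (1 : ℝ≥0∞) ≤ 𝒩[ω] - ℳ[Φ, t, ω]}) ∪ {ω : MarkedConfig | 𝒩[ω] = ⊤})

namespace FlowContinuity

variable {σ : ℝ}

/-! ### The counts: measurability and the sure inequalities -/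

/-- `N` is measurable. [folklore] -/
theorem measurable_cellCount : Measurable fun ω : MarkedConfig => 𝒩[ω] :=
  measurable_from_top.comp (f := fun ω : MarkedConfig => ω.count (Prod.fst ⁻¹' unitCell))
    (g := fun n : ℕ∞ => (n : ℝ≥0∞)) (PointConfig.measurable_count (measurableSet_unitCell.preimage measurable_fst))

/-- The tracked sections form a jointly measurable subset of `MarkedConfig × (ℝ³ × ℝ³)`. [folklore] -/
theorem measurableSet_trackedSection_prod (Φ : InfiniteHardSphereFlow (Fin 3) σ) (t : ℝ) :
    MeasurableSet {q : MarkedConfig × (V3 × V3) | q.2 ∈ 𝒯[Φ, t, q.1]} := by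
  have hW : MeasurableSet (Prod.fst ⁻¹' unitCell : Set (V3 × V3)) := measurableSet_unitCell.preimage measurable_fst
  have h1 : MeasurableSet {q : MarkedConfig × (V3 × V3) | q.2 ∈ (Prod.fst ⁻¹' unitCell : Set (V3 × V3))} :=
    hW.preimage measurable_snd
  have h2 : MeasurableSet {q : MarkedConfig × (V3 × V3) |
      (q.2.1 + t • q.2.2, q.2.2) ∈ (Prod.fst ⁻¹' unitCell : Set (V3 × V3))} :=
    hW.preimage ((measurable_freeFlight t).comp measurable_snd)
  have h3 : MeasurableSet {q : MarkedConfig × (V3 × V3) | (q.2.1 + t • q.2.2, q.2.2) ∈ Φ.flow t q.1} :=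
    measurableSet_mem_config ((measurable_freeFlight t).comp measurable_snd)
      ((Φ.measurable_flow t).comp measurable_fst)
  exact h1.inter (h2.inter h3)

/-- Each tracked section is a measurable subset of phase space. [folklore] -/
theorem measurableSet_trackedSection (Φ : InfiniteHardSphereFlow (Fin 3) σ) (t : ℝ) (ω : MarkedConfig) :
    MeasurableSet 𝒯[Φ, t, ω] :=
  measurable_prodMk_left (measurableSet_trackedSection_prod Φ t)

/-- **`M_t` is measurable** (a measurably parametrised count, `PointConfig.measurable_toMeasure_preimage`).
[folklore] -/
theorem measurable_trackedCount (Φ : InfiniteHardSphereFlow (Fin 3) σ) (t : ℝ) :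
    Measurable fun ω : MarkedConfig => ℳ[Φ, t, ω] := by
  have h := PointConfig.measurable_toMeasure_preimage (measurableSet_trackedSection_prod Φ t)
    (measurable_id (α := MarkedConfig))
  have e : (fun ω : MarkedConfig => ℳ[Φ, t, ω]) = fun ω : MarkedConfig =>
      (id ω : MarkedConfig).toMeasure (Prod.mk ω ⁻¹' {q : MarkedConfig × (V3 × V3) | q.2 ∈ 𝒯[Φ, t, q.1]}) := by
    funext ω
    exact (PointConfig.toMeasure_apply _ (measurableSet_trackedSection Φ t ω)).symm
  rw [e]
  exact h

/-- The tracked particles are particles over the cell. [folklore] -/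
theorem trackedSection_subset (Φ : InfiniteHardSphereFlow (Fin 3) σ) (t : ℝ) (ω : MarkedConfig) :
    (ω : Set (V3 × V3)) ∩ 𝒯[Φ, t, ω] ⊆ (ω : Set (V3 × V3)) ∩ Prod.fst ⁻¹' unitCell :=
  fun _ hp => ⟨hp.1, hp.2.1⟩

/-- **Sure inequality** `M_t(ω) ≤ N(ω)`. [folklore] -/
theorem trackedCount_le_cellCount (Φ : InfiniteHardSphereFlow (Fin 3) σ) (t : ℝ) (ω : MarkedConfig) :
    ℳ[Φ, t, ω] ≤ 𝒩[ω] :=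
  ENat.toENNReal_le.2 (encard_le_encard (trackedSection_subset Φ t ω))

/-- The free flights of the tracked particles are particles of `Φ_t ω` over the cell. [folklore] -/
theorem image_trackedSection_subset (Φ : InfiniteHardSphereFlow (Fin 3) σ) (t : ℝ) (ω : MarkedConfig) :
    (fun p : V3 × V3 => (p.1 + t • p.2, p.2)) '' ((ω : Set (V3 × V3)) ∩ 𝒯[Φ, t, ω]) ⊆
      (Φ.flow t ω : Set (V3 × V3)) ∩ Prod.fst ⁻¹' unitCell := by
  rintro _ ⟨p, hp, rfl⟩
  exact ⟨hp.2.2.2, hp.2.2.1⟩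

/-- **Sure inequality** `M_t(ω) ≤ N(Φ_t ω)`: free flight is injective and maps the tracked particles to
particles of the evolved configuration over the cell. [folklore] -/
theorem trackedCount_le_cellCount_flow (Φ : InfiniteHardSphereFlow (Fin 3) σ) (t : ℝ) (ω : MarkedConfig) :
    ℳ[Φ, t, ω] ≤ 𝒩[Φ.flow t ω] := by
  refine ENat.toENNReal_le.2 ?_
  change ((ω : Set (V3 × V3)) ∩ 𝒯[Φ, t, ω]).encard ≤
    ((Φ.flow t ω : Set (V3 × V3)) ∩ Prod.fst ⁻¹' unitCell).encard
  rw [← (freeFlight_injective t).injOn.encard_image]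
  exact encard_le_encard (image_trackedSection_subset Φ t ω)

/-! ### Exact transport of the cell observables off the bad event -/

/-- **The cell observables are transported exactly off the bad event**: if `N(ω) < ∞`,
`¬ (1 ≤ N(ω) - M_t(ω))` and `¬ (1 ≤ N(Φ_t ω) - M_t(ω))`, then `A_h(Φ_t ω) = A_h(ω)` for every `h`
(both inclusions of the counting argument are equalities of finite sets; part 1,
`cellObs_eq_of_inter_eq_image`). [folklore] -/
theorem cellObs_flow_eq (Φ : InfiniteHardSphereFlow (Fin 3) σ) (t : ℝ) {ω : MarkedConfig}
    (hfin : 𝒩[ω] ≠ ⊤) (h0 : ¬ (1 : ℝ≥0∞) ≤ 𝒩[ω] - ℳ[Φ, t, ω])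
    (h1 : ¬ (1 : ℝ≥0∞) ≤ 𝒩[Φ.flow t ω] - ℳ[Φ, t, ω]) (h : V3 → ℝ) :
    cellObs h (Φ.flow t ω) = cellObs h ω := by
  have hF : ((ω : Set (V3 × V3)) ∩ Prod.fst ⁻¹' unitCell).Finite := by
    rw [← encard_ne_top_iff]
    exact fun h' => hfin (by rw [ENat.toENNReal_eq_top]; exact h')
  have hle0 : ω.count (Prod.fst ⁻¹' unitCell) ≤ ω.count 𝒯[Φ, t, ω] := enat_le_of_not_one_le_sub h0
  have hle1 : (Φ.flow t ω).count (Prod.fst ⁻¹' unitCell) ≤ ω.count 𝒯[Φ, t, ω] :=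
    enat_le_of_not_one_le_sub h1
  have hS : (ω : Set (V3 × V3)) ∩ 𝒯[Φ, t, ω] = (ω : Set (V3 × V3)) ∩ Prod.fst ⁻¹' unitCell :=
    (hF.subset (trackedSection_subset Φ t ω)).eq_of_subset_of_encard_le (trackedSection_subset Φ t ω) hle0
  have hI : (fun p : V3 × V3 => (p.1 + t • p.2, p.2)) '' ((ω : Set (V3 × V3)) ∩ 𝒯[Φ, t, ω]) =
      (Φ.flow t ω : Set (V3 × V3)) ∩ Prod.fst ⁻¹' unitCell :=
    ((hF.subset (trackedSection_subset Φ t ω)).image _).eq_of_subset_of_encard_le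
      (image_trackedSection_subset Φ t ω)
      (by rw [(freeFlight_injective t).injOn.encard_image]; exact hle1)
  exact cellObs_eq_of_inter_eq_image (t := t) (by rw [← hI, hS]) h

/-- The bad event is measurable. [folklore] -/
theorem measurableSet_badSet (Φ : InfiniteHardSphereFlow (Fin 3) σ) (t : ℝ) : MeasurableSet ℬ[Φ, t] :=
  ((measurableSet_le measurable_const
      ((measurable_cellCount.comp (Φ.measurable_flow t)).sub (measurable_trackedCount Φ t))).union
    (measurableSet_le measurable_const (measurable_cellCount.sub (measurable_trackedCount Φ t)))).union
    (measurable_cellCount (measurableSet_singleton ⊤))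

/-- Off the bad event the cell observables are transported exactly: `A_h(Φ_t ω) = A_h(ω)`. [folklore] -/
theorem cellObs_flow_eq_of_not_mem_badSet (Φ : InfiniteHardSphereFlow (Fin 3) σ) {t : ℝ} {ω : MarkedConfig}
    (hω : ω ∉ ℬ[Φ, t]) (h : V3 → ℝ) : cellObs h (Φ.flow t ω) = cellObs h ω := by
  simp only [mem_union, mem_setOf_eq, not_or] at hω
  exact cellObs_flow_eq Φ t hω.2 hω.1.2 hω.1.1 h

/-! ### Almost sure eventual equality `M_t = N` -/

/-- **Eventual equality `M_t(ω) = N(ω)`**: for a good configuration with finitely many particles over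
the cell, all with positions in the open cube, every one of them is tracked for all small `t ≥ 0`
(initial free flight `eventually_traj_eq_freeFlight`, evolved particle by `coe_flow`, openness of the
cube). [folklore] -/
theorem eventually_trackedCount_eq (Φ : InfiniteHardSphereFlow (Fin 3) σ) {ω : MarkedConfig}
    (hω : ω ∈ Φ.good) (hfin : ((ω : Set (V3 × V3)) ∩ Prod.fst ⁻¹' unitCell).Finite)
    (hint : ∀ p ∈ (ω : Set (V3 × V3)) ∩ Prod.fst ⁻¹' unitCell, p.1 ∈ {q : V3 | ∀ i, q i ∈ Ioo (0 : ℝ) 1}) :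
    ∀ᶠ t in 𝓝[≥] (0 : ℝ), ℳ[Φ, t, ω] = 𝒩[ω] := by
  have hall : ∀ᶠ t in 𝓝[≥] (0 : ℝ), ∀ p ∈ (ω : Set (V3 × V3)) ∩ Prod.fst ⁻¹' unitCell, p ∈ 𝒯[Φ, t, ω] := by
    refine hfin.eventually_all.2 fun p hp => ?_
    have h1 := eventually_traj_eq_freeFlight Φ hω (show p ∈ ω from hp.1)
    have h2 : ∀ᶠ t in 𝓝[≥] (0 : ℝ), p.1 + t • p.2 ∈ {q : V3 | ∀ i, q i ∈ Ioo (0 : ℝ) 1} :=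
      mem_nhdsWithin_of_mem_nhds (eventually_freeFlight_fst_mem_openCube (hint p hp))
    filter_upwards [h1, h2] with t ht ht'
    refine ⟨hp.2, fun i => Ioo_subset_Ico_self (ht' i), ?_⟩
    have hmem : Φ.traj ω p t ∈ ((Φ.flow t ω : MarkedConfig) : Set (V3 × V3)) := by
      rw [Φ.coe_flow ω hω t]
      exact ⟨p, hp.1, rfl⟩
    rw [ht] at hmem
    exact hmem
  filter_upwards [hall] with t ht
  have hset : ω.carrier ∩ 𝒯[Φ, t, ω] = ω.carrier ∩ Prod.fst ⁻¹' unitCell :=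
    Subset.antisymm (trackedSection_subset Φ t ω) fun p hp => ⟨hp.1, ht p hp⟩
  simp only [PointConfig.count, hset]

/-! ### The stationarity count: the bad event has probability `→ 0` -/

/-- **The stationarity count.** Under a DLR state `G` of unit hard spheres which the flow leaves invariant
and for which it is a.e. defined, `G(bad_t) → 0` as `t → 0⁺`: `E[M_t] → E[N]` by dominated convergence
(`M_t ≤ N ≤ 8`, `M_t → N` a.s. on good face-free configurations), `E[N ∘ Φ_t] = E[N]` by stationarity, and
Markov's inequality bounds both `G{1 ≤ N ∘ Φ_t - M_t}` and `G{1 ≤ N - M_t}` by `E[N] - E[M_t]`.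
[folklore] -/
theorem tendsto_measure_badSet (Φ : InfiniteHardSphereFlow (Fin 3) 1) {z β : ℝ} {u : V3}
    {G : Measure MarkedConfig} [IsProbabilityMeasure G] (hG : IsHardSphereGibbs 1 z β u G)
    (hD : Φ.IsAEDefined G) (hS : Φ.IsStationary G) :
    Tendsto (fun t : ℝ => G ℬ[Φ, t]) (𝓝[≥] 0) (𝓝 0) := by
  -- a.s. convergence of the tracked counts
  have hconv : ∀ᵐ ω ∂G, Tendsto (fun t : ℝ => ℳ[Φ, t, ω]) (𝓝[≥] 0) (𝓝 𝒩[ω]) := by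
    filter_upwards [hD, compl_mem_ae_iff.2 (measure_faceEvent hG)] with ω hω hωf
    have hhc : IsHardCore 1 ω := Φ.isHardCore_of_mem_good hω
    have hfin : ((ω : Set (V3 × V3)) ∩ Prod.fst ⁻¹' unitCell).Finite :=
      ((hhc.posLocallyFinite one_pos) (Metric.closedBall (0 : V3) 4) (isCompact_closedBall _ _)).subset
        fun p hp => ⟨hp.1, mem_closedBall_zero_iff.2 ((norm_le_of_mem_unitCell hp.2).trans (by norm_num))⟩
    have hint : ∀ p ∈ (ω : Set (V3 × V3)) ∩ Prod.fst ⁻¹' unitCell, p.1 ∈ {q : V3 | ∀ i, q i ∈ Ioo (0 : ℝ) 1} :=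
      fun p hp => fst_mem_openCube_of_count_faces_eq_zero (not_not.1 hωf) hp.1 hp.2
    exact tendsto_const_nhds.congr' ((eventually_trackedCount_eq Φ hω hfin hint).mono fun t ht => ht.symm)
  have h8 := count_cell_le_eight_ae hG
  have hI8 : ∫⁻ ω, 𝒩[ω] ∂G ≤ 8 :=
    (lintegral_mono_ae h8).trans (by rw [lintegral_const, measure_univ, mul_one])
  have hfinI : ∫⁻ ω, 𝒩[ω] ∂G ≠ ⊤ := ne_top_of_le_ne_top (by norm_num) hI8
  have hlim : Tendsto (fun t : ℝ => ∫⁻ ω, ℳ[Φ, t, ω] ∂G) (𝓝[≥] 0) (𝓝 (∫⁻ ω, 𝒩[ω] ∂G)) :=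
    tendsto_lintegral_filter_of_dominated_convergence (fun ω => 𝒩[ω])
      (Eventually.of_forall fun t => measurable_trackedCount Φ t)
      (Eventually.of_forall fun t => ae_of_all _ fun ω => trackedCount_le_cellCount Φ t ω) hfinI hconv
  set gap : ℝ → ℝ≥0∞ := fun t => ∫⁻ ω, 𝒩[ω] ∂G - ∫⁻ ω, ℳ[Φ, t, ω] ∂G with hgap_def
  have hgap : Tendsto gap (𝓝[≥] 0) (𝓝 0) := by
    have h := ENNReal.Tendsto.sub (tendsto_const_nhds (x := ∫⁻ ω, 𝒩[ω] ∂G)) hlim (Or.inl hfinI)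
    rwa [tsub_self] at h
  -- Markov bounds
  have hM1 : ∀ t : ℝ, G {ω | (1 : ℝ≥0∞) ≤ 𝒩[ω] - ℳ[Φ, t, ω]} ≤ gap t := fun t => by
    have h := mul_meas_ge_le_lintegral₀
      ((measurable_cellCount.sub (measurable_trackedCount Φ t)).aemeasurable (μ := G)) 1
    rw [one_mul] at h
    refine h.trans (le_of_eq ?_)
    exact lintegral_sub (measurable_trackedCount Φ t)
      (ne_top_of_le_ne_top hfinI (lintegral_mono fun ω => trackedCount_le_cellCount Φ t ω))
      (ae_of_all _ fun ω => trackedCount_le_cellCount Φ t ω)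
  have hM2 : ∀ t : ℝ, G {ω | (1 : ℝ≥0∞) ≤ 𝒩[Φ.flow t ω] - ℳ[Φ, t, ω]} ≤ gap t := fun t => by
    have hpres : ∫⁻ ω, 𝒩[Φ.flow t ω] ∂G = ∫⁻ ω, 𝒩[ω] ∂G :=
      (hS.measurePreserving t).lintegral_comp measurable_cellCount
    have h := mul_meas_ge_le_lintegral₀
      (((measurable_cellCount.comp (Φ.measurable_flow t)).sub (measurable_trackedCount Φ t)).aemeasurable
        (μ := G)) 1
    rw [one_mul] at h
    refine h.trans (le_of_eq ?_)
    have hfin' : ∫⁻ ω, ℳ[Φ, t, ω] ∂G ≠ ⊤ :=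
      ne_top_of_le_ne_top (hpres ▸ hfinI) (lintegral_mono fun ω => trackedCount_le_cellCount_flow Φ t ω)
    change ∫⁻ ω, 𝒩[Φ.flow t ω] - ℳ[Φ, t, ω] ∂G = gap t
    rw [lintegral_sub (measurable_trackedCount Φ t) hfin'
      (ae_of_all _ fun ω => trackedCount_le_cellCount_flow Φ t ω), hpres]
  have hM3 : G {ω | 𝒩[ω] = ⊤} = 0 := by
    rw [← compl_mem_ae_iff]
    filter_upwards [h8] with ω hω
    intro h'
    rw [mem_setOf_eq] at h'
    rw [h'] at hω
    exact absurd hω (by norm_num)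
  have hbound : ∀ t : ℝ, G ℬ[Φ, t] ≤ gap t + gap t := fun t =>
    calc G ℬ[Φ, t]
        ≤ G ({ω | (1 : ℝ≥0∞) ≤ 𝒩[Φ.flow t ω] - ℳ[Φ, t, ω]} ∪ {ω | (1 : ℝ≥0∞) ≤ 𝒩[ω] - ℳ[Φ, t, ω]}) +
            G {ω | 𝒩[ω] = ⊤} :=
          measure_union_le _ _
      _ ≤ (G {ω | (1 : ℝ≥0∞) ≤ 𝒩[Φ.flow t ω] - ℳ[Φ, t, ω]} + G {ω | (1 : ℝ≥0∞) ≤ 𝒩[ω] - ℳ[Φ, t, ω]}) + 0 :=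
          add_le_add (measure_union_le _ _) hM3.le
      _ ≤ gap t + gap t := by rw [add_zero]; exact add_le_add (hM2 t) (hM1 t)
  have h2gap : Tendsto (fun t => gap t + gap t) (𝓝[≥] 0) (𝓝 0) := by simpa using hgap.add hgap
  exact tendsto_of_tendsto_of_tendsto_of_le_of_le tendsto_const_nhds h2gap (fun t => zero_le) hbound

end FlowContinuity

open FlowContinuity

/-- **Registered stub `stub_flowMeanSquareContinuity` (hypothesis (D2) of `dynamicClusteringOneBody_of`):
right mean-square continuity at `t = 0` of `t ↦ A_h ∘ Φ_t` in `L²(G)`** for every unit-diameter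
equilibrium flow `Φ`, every DLR state `G` of unit hard spheres at unit inverse temperature (any activity
`z > 0`) and every continuous polynomially bounded `h` — Doyon's strong continuity of the dynamics on the
GNS space (Doyon 2022 Thm 4.11) for the one-body cell observables, DERIVED from the structure axioms of
the flow and stationarity by the stationarity count: `A_h ∘ Φ_t = A_h` off an event of probability `→ 0`
(`cellObs_flow_eq_of_not_mem_badSet`, `tendsto_measure_badSet`) and Vitali along the measure-preserving
family `Φ_t` (`tendsto_integral_sq_sub_of_measure_tendsto_zero`). [cite: Doyon2022, §4.3 Thm 4.11] -/
theorem stub_flowMeanSquareContinuity :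
    ∀ Φ : InfiniteHardSphereFlow (Fin 3) 1, Φ.IsEquilibriumFlow → ∀ z : ℝ, 0 < z →
      ∀ G : Measure MarkedConfig, IsHardSphereGibbs 1 z 1 (0 : V3) G →
        ∀ h : V3 → ℝ, Continuous h → (∃ (C : ℝ) (k : ℕ), ∀ v, |h v| ≤ C * (1 + ‖v‖) ^ k) →
          Tendsto (fun t : ℝ => ∫ ω, (cellObs h (Φ.flow t ω) - cellObs h ω) ^ 2 ∂G) (𝓝[≥] 0) (𝓝 0) := by
  intro Φ hΦ z hz G hG h hh hhb
  haveI : IsProbabilityMeasure G := hG.1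
  have hD : Φ.IsAEDefined G := (hΦ z 1 hz one_pos G hG).1
  have hS : Φ.IsStationary G := (hΦ z 1 hz one_pos G hG).2
  obtain ⟨C, k, hC⟩ := hhb
  have hG' : IsHardSphereGibbs 1 z (1 : ℝ)⁻¹ (0 : V3) G := by
    rw [inv_one]
    exact hG
  have hA2 : MemLp (cellObs h) 2 G := memLp_two_cellObs_of_isHardSphereGibbs hz.le one_pos hG' hh.measurable hC
  exact tendsto_integral_sq_sub_of_measure_tendsto_zero (fun t => hS.measurePreserving t)
    (measurable_cellObs hh.measurable) hA2 (fun t => ℬ[Φ, t]) (fun t => measurableSet_badSet Φ t)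
    (fun t ω hω => cellObs_flow_eq_of_not_mem_badSet Φ hω h) (tendsto_measure_badSet Φ hG hD hS)

end Summit.AtomisticToContinuum.HydrodynamicLimit.Theorems.MourreKoopmanChargesOneBodyCompleteness

end
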